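import Summits.NavierStokesRegularity.FluidComputer.PalasekTowerClayBridge

/-!
# Rate consequences for the E-C interface: non-vacuity of DC1/DC4, Type II, accumulation of the clock

Cell `ns-blowup`, seat `ns-blowup-ecbridge-1`; companion of `PalasekTowerClayBridge.lean` (LABEL:
E-C typing; WHAT THIS IS NOT: not Navier–Stokes — arithmetic of the rates and one squeeze argument).
* `TowerRates.canonical` — the constraints DC1/DC4 are jointly satisfiable (`b = 1.1`, `β = 2.3`,
  `α = 2.45`), so the interface is not vacuous at the level of rates;
* `TowerRates.typeII_exponent` — `β/2 < b(β-1)`: along the readout times the velocity floors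
  `Y_{k+1} = N_k^{b(β-1)}` outrun the Leray / Type-I scale `(T - τ_{k+1})^{-1/2} ≲ A_k^{1/2} = N_k^{β/2}`
  given by the clock (KILLSHEET V.2: zone Z1, Type II);
* `Realisation.tendsto_τ` — the clock forces `τ k → T`: infinitely many levels act before `T`.

References: S. Palasek, arXiv:2605.13827 §3 [cite: Palasek2026ElementaryModel, §3 (3.2)].
-/

noncomputable section

namespace Summit.NavierStokesRegularity.FluidComputer.PalasekTowerClayBridge

open Set Filter Topology Function
open scoped ContDiff

namespace TowerRates

variable (R : TowerRates)

/-- The amplitudes `A_k = N_k^β` tend to infinity. [folklore] -/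
theorem tendsto_A_atTop : Tendsto R.A atTop atTop := by
  have hβ : 0 < R.β := by linarith [R.two_lt_β]
  exact (tendsto_rpow_atTop hβ).comp R.tendsto_N_atTop

/-- **Type II along the ladder (exponent form).** With `N := N_k`, the level-`(k+1)` velocity is
`Y_{k+1} = N^{b(β-1)}` while the Leray / Type-I scale at its readout time is
`(T - τ_{k+1})^{-1/2} ≲ A_k^{1/2} = N^{β/2}` (the clock); `β/2 < b(β-1)` holds on the whole admissible
set (indeed whenever `b ≥ 1`, `β > 2`), so the floors outrun the Type-I rate by the factor
`N^{b(β-1) - β/2} → ∞` (KILLSHEET V.2: zone Z1, Type II). [folklore] -/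
theorem typeII_exponent : R.β / 2 < R.b * (R.β - 1) := by
  have hb := R.one_lt_b
  have hβ := R.two_lt_β
  nlinarith

/-- **The constraints DC1/DC4 are jointly satisfiable** (so the interface below is not vacuous at
the level of rates): `N₀ = 2`, `b = 11/10`, `β = 23/10`, `α = 49/20` — `2b = 2.2 < 2.3 = β < 2.45 = α
≤ 5/2` and `β = 2.3 < 2.4 < 1 + √2`. Any `b < (1 + √2)/2 ≈ 1.207` admits such a window. [folklore] -/
def canonical : TowerRates where
  N₀ := 2
  b := 11 / 10
  β := 23 / 10
  α := 49 / 20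
  one_lt_N₀ := by norm_num
  one_lt_b := by norm_num
  two_b_lt_β := by norm_num
  β_lt_α := by norm_num
  two_lt_α := by norm_num
  α_le := by norm_num
  β_lt_one_add_sqrt_two := by
    have h : (7 : ℝ) / 5 < Real.sqrt 2 := by
      rw [Real.lt_sqrt (by norm_num)]
      norm_num
    linarith

end TowerRates

namespace Realisation

variable {ν : ℝ} {R : TowerRates} (W : Realisation ν R)

/-- The clock forces the readout times to accumulate at the blow-up time: `τ k → T`
(`T - c₃/A_k ≤ τ (k+1) < T` and `A_k → ∞`), so infinitely many levels act before `T`. [folklore] -/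
theorem tendsto_τ : Tendsto W.τ atTop (𝓝 W.T) := by
  have hlow : Tendsto (fun k => W.T - W.c₃ / R.A k) atTop (𝓝 W.T) := by
    have h0 : Tendsto (fun k => W.c₃ / R.A k) atTop (𝓝 0) :=
      tendsto_const_nhds.div_atTop R.tendsto_A_atTop
    simpa using tendsto_const_nhds.sub h0
  have hshift : Tendsto (fun k => W.τ (k + 1)) atTop (𝓝 W.T) :=
    tendsto_of_tendsto_of_tendsto_of_le_of_le hlow tendsto_const_nhds
      (fun k => by linarith [W.clock k]) (fun k => (W.τ_mem (k + 1)).2.le)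
  exact (tendsto_add_atTop_iff_nat 1).1 hshift

end Realisation

end Summit.NavierStokesRegularity.FluidComputer.PalasekTowerClayBridge

end
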